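import Literature.NumberTheory.NumberFields.CyclicPrimePowerUniquePrimeOver
import HarnessLib

/-!
# The relative form: in a CYCLIC extension `E/F` of number fields of prime-power degree, a prime of `F` with ONE prime above it in an
# intermediate field `M ≠ F` has ONE prime above it in `E`

Topic `NumberTheory/NumberFields` (namespace = path).  THEOREM-ONLY file (no definition, no named fact, no instance, no `sorry`),
written by the prover seat `bsd-line-att-p3` g30 (cell `bsd-f1-sign2`; `--supports` stmt-BirchSwinnertonDyer-22298; closes nothing).
Sequel of `CyclicPrimePowerUniquePrimeOver.lean` (the case `F = ℚ`, primes of `ℤ`): the same Frattini argument over an arbitrary number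
field base `F` and a nonzero prime `P` of `𝓞 F`.

* **`ncard_primesOver_eq_one_of_isCyclic_of_base`** — `E/F` Galois with `Gal(E/F)` cyclic of order `p^n`, `F ⊆ M ⊆ E` with `[M : F] > 1`,
  `P` a maximal ideal of `𝓞 F` with exactly ONE prime of `𝓞 M` above it ⟹ exactly ONE prime of `𝓞 E` above `P`.
* `ncard_primesOver_eq_one_of_algebra_of_eq_one_of_base` (one prime upstairs ⟹ one prime in the subfield),
  `ncard_primesOver_le_of_algebra_of_base`, **`ncard_primesOver_eq_one_iff_of_isCyclic_of_base`**.
* `ncard_primesOver_dvd_finrank_of_base` (`g ∣ [E : F]`), `ncard_primesOver_le_finrank_mul_of_base` (`g_E(P) ≤ [E : M] · g_M(P)`, via the Galois tower count; the `ℤ`-prime form is the tree`s `ncard_primesOver_le_finrank_mul`).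

Use (this seat): «decomposition stabilises once it stalls» along the cyclotomic `ℤ₂`-tower — if a rational prime has as many primes in
`ℚ_{a+1}` as in `ℚ_a`, it has that many in every `ℚ_n`, `n ≥ a` (`IwasawaTheory/CyclotomicTwoTowerOddPrimeDecompositionExact.lean`).

HONEST SCOPE: textbook Hilbert theory; nothing here is specific to any summit; BSD is not proved by any of this.

## References
* D. A. Marcus, *Number Fields*, 2nd ed. (2018), Ch. 4 Thm. 28 (decomposition groups; cyclic case). [Marcus2018]
* J. Neukirch, *Algebraic Number Theory* (1999), Ch. I §9 (9.1)–(9.4). [NeukirchANT1999]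
-/

set_option autoImplicit false

noncomputable section

open NumberField IsDedekindDomain Ideal Module
open scoped Pointwise

namespace Literature.NumberTheory.NumberFields

section Relative

variable (F : Type*) [Field F] [NumberField F] (E : Type*) [Field E] [NumberField E] [Algebra F E]
  (M : Type*) [Field M] [NumberField M] [Algebra F M] [Algebra M E] [IsScalarTower F M E]

omit [NumberField F] [NumberField M] in
/-- **`g_M(P) ≤ g_E(P)`**: every prime of `M` above the prime `P` of `F` lies under some prime of `E` above `P` (going up).
[cite: NeukirchANT1999, Ch. I §9 (9.1)] -/
theorem ncard_primesOver_le_of_algebra_of_base (P : Ideal (𝓞 F)) [P.IsMaximal] :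
    (P.primesOver (𝓞 M)).ncard ≤ (P.primesOver (𝓞 E)).ncard := by
  classical
  have hsub : P.primesOver (𝓞 M) ⊆ (fun 𝔔 : Ideal (𝓞 E) => 𝔔.under (𝓞 M)) '' P.primesOver (𝓞 E) := by
    intro Q hQ
    haveI := hQ.1
    haveI := hQ.2
    obtain ⟨⟨R, hR, hRQ⟩⟩ := Q.nonempty_primesOver (S := 𝓞 E)
    haveI := hR
    haveI := hRQ
    exact ⟨R, ⟨hR, Ideal.LiesOver.trans R Q P⟩, hRQ.over.symm⟩
  exact le_trans (Set.ncard_le_ncard hsub (Set.Finite.image _ (IsDedekindDomain.primesOver_finite _ _)))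
    (Set.ncard_image_le (IsDedekindDomain.primesOver_finite _ _))

omit [NumberField F] in
/-- **One prime of `E` above `P` ⟹ one prime of every intermediate `M` above `P`.** [cite: NeukirchANT1999, Ch. I §9 (9.1)] -/
theorem ncard_primesOver_eq_one_of_algebra_of_eq_one_of_base (P : Ideal (𝓞 F)) [P.IsMaximal]
    (hone : (P.primesOver (𝓞 E)).ncard = 1) : (P.primesOver (𝓞 M)).ncard = 1 := by
  refine le_antisymm (hone ▸ ncard_primesOver_le_of_algebra_of_base F E M P) ?_
  obtain ⟨⟨Q, hQ⟩⟩ := P.nonempty_primesOver (S := 𝓞 M)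
  exact (Set.ncard_pos (IsDedekindDomain.primesOver_finite _ _)).mpr ⟨Q, hQ⟩

variable [IsGalois F E]

/-- **`g_E(P) ∣ [E : F]`** for `E/F` Galois (fundamental identity `g · e · f = [E : F]`). [cite: NeukirchANT1999, Ch. I §9 (9.2)] -/
theorem ncard_primesOver_dvd_finrank_of_base (P : Ideal (𝓞 F)) [P.IsMaximal] :
    (P.primesOver (𝓞 E)).ncard ∣ Module.finrank F E := by
  have h := Ideal.ncard_primesOver_mul_ramificationIdxIn_mul_inertiaDegIn P (𝓞 E) (E ≃ₐ[F] E)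
  rw [IsGalois.card_aut_eq_finrank] at h
  exact ⟨_, h.symm⟩

/-- **Cyclic extensions of prime-power degree, relative form: a prime of `F` with ONE prime above it in an intermediate field `M ≠ F`
has ONE prime above it in `E`.**  `E/F` Galois with `Gal(E/F)` cyclic of order `p^n`, `F ⊆ M ⊆ E` with `[M : F] > 1`, `P ≠ 0` a prime of
`𝓞 F` with a unique prime `q` of `𝓞 M` above it.  For `Q ∣ P` in `E` and `σ ∈ G`: `σQ ∩ M = q = Q ∩ M`, so `σQ = τQ` for some `τ ∈ Gal(E/M)`
(transitivity above `q`); thus `G = Gal(E/M) · Stab(Q)`, whence `Stab(Q) = G` (Frattini in the cyclic `p`-group) and `Q` is the only prime above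
`P`. [cite: Marcus2018, Ch. 4 Thm. 28 (decomposition groups; cyclic case)] [cite: NeukirchANT1999, Ch. I §9 (9.1)–(9.4)] -/
theorem ncard_primesOver_eq_one_of_isCyclic_of_base [IsCyclic (E ≃ₐ[F] E)] {p n : ℕ} (hp : p.Prime)
    (hcard : Module.finrank F E = p ^ n) (hM : 1 < Module.finrank F M) (P : Ideal (𝓞 F)) [P.IsMaximal]
    (hone : (P.primesOver (𝓞 M)).ncard = 1) : (P.primesOver (𝓞 E)).ncard = 1 := by
  classical
  set G := (E ≃ₐ[F] E) with hGdef
  have hG : Nat.card G = p ^ n := by rw [hGdef, IsGalois.card_aut_eq_finrank, hcard]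
  -- a prime `Q` of `E` above `P`, and the prime `q = Q ∩ 𝓞 M` of `M` below it
  obtain ⟨⟨Q, hQprime, hQover⟩⟩ := P.nonempty_primesOver (S := 𝓞 E)
  haveI := hQprime
  haveI := hQover
  set q : Ideal (𝓞 M) := Q.under (𝓞 M) with hqdef
  haveI hqQ : Q.LiesOver q := ⟨rfl⟩
  haveI : q.IsPrime := Ideal.IsPrime.under (𝓞 M) Q
  have hqP : q.LiesOver P := Ideal.LiesOver.tower_bot Q q P
  -- uniqueness of the prime of `M` above `P`
  obtain ⟨q₀, hq₀⟩ := Set.ncard_eq_one.mp hone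
  have huniq : ∀ q' : Ideal (𝓞 M), q'.IsPrime → q'.LiesOver P → q' = q := by
    intro q' h1 h2
    have ha : q' ∈ P.primesOver (𝓞 M) := ⟨h1, h2⟩
    have hb : q ∈ P.primesOver (𝓞 M) := ⟨inferInstance, hqP⟩
    rw [hq₀, Set.mem_singleton_iff] at ha hb
    rw [ha, hb]
  -- `H = Gal(E/M) ≤ G`
  set H : Subgroup G := fixingSubgroup G (Set.range (algebraMap M E)) with hHdef
  haveI hHME : IsGaloisGroup H M E := IsGaloisGroup.of_isScalarTower G F E M
  haveI hHME' : IsGaloisGroup H (𝓞 M) (𝓞 E) := IsGaloisGroup.of_isFractionRing H (𝓞 M) (𝓞 E) M E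
  have hHcard : Nat.card H = Module.finrank M E := IsGaloisGroup.card_eq_finrank H M E
  have hHne : H ≠ ⊤ := by
    intro hH
    have h1 : Nat.card H = Nat.card G := by rw [hH, Subgroup.card_top]
    have h2 : Module.finrank F M * Module.finrank M E = Module.finrank F E := Module.finrank_mul_finrank F M E
    rw [hHcard, hGdef, IsGalois.card_aut_eq_finrank] at h1
    have hpos : 0 < Module.finrank M E := Module.finrank_pos
    nlinarith
  -- `D = Stab_G(Q)` and `G = H · D`
  set D : Subgroup G := MulAction.stabilizer G Q with hDdef
  have hHD : ∀ σ : G, ∃ τ ∈ H, ∃ δ ∈ D, σ = τ * δ := by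
    intro σ
    haveI : (σ • Q).IsPrime := hQprime.smul σ
    haveI : (σ • Q).LiesOver P := hQover.smul σ
    have hq' : (σ • Q).under (𝓞 M) = q :=
      huniq _ (Ideal.IsPrime.under (𝓞 M) (σ • Q)) (Ideal.LiesOver.tower_bot (σ • Q) ((σ • Q).under (𝓞 M)) P)
    haveI : (σ • Q).LiesOver q := ⟨hq'.symm⟩
    obtain ⟨τ, hτ⟩ := Ideal.exists_smul_eq_of_isGaloisGroup q Q (σ • Q) H
    have hτ' : (τ : G) • Q = σ • Q := by
      rw [← hτ]
      rfl
    refine ⟨τ, τ.2, (τ : G)⁻¹ * σ, ?_, by group⟩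
    rw [hDdef, MulAction.mem_stabilizer_iff, mul_smul, ← hτ', ← mul_smul, inv_mul_cancel, one_smul]
  have hDtop : D = ⊤ := eq_top_of_forall_exists_mul_of_isCyclic hp hG H D hHne hHD
  have horbit := Algebra.IsInvariant.orbit_eq_primesOver (𝓞 F) (𝓞 E) G P Q
  rw [← horbit, ← MulAction.index_stabilizer, ← hDdef, hDtop, Subgroup.index_top]

/-- **`g_E(P) = 1 ⟺ g_M(P) = 1`** for `E/F` cyclic of prime-power degree and `F ⊊ M ⊆ E`.
[cite: Marcus2018, Ch. 4 Thm. 28 (decomposition groups; cyclic case)] -/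
theorem ncard_primesOver_eq_one_iff_of_isCyclic_of_base [IsCyclic (E ≃ₐ[F] E)] {p n : ℕ} (hp : p.Prime)
    (hcard : Module.finrank F E = p ^ n) (hM : 1 < Module.finrank F M) (P : Ideal (𝓞 F)) [P.IsMaximal] :
    (P.primesOver (𝓞 E)).ncard = 1 ↔ (P.primesOver (𝓞 M)).ncard = 1 :=
  ⟨ncard_primesOver_eq_one_of_algebra_of_eq_one_of_base F E M P,
    ncard_primesOver_eq_one_of_isCyclic_of_base F E M hp hcard hM P⟩

end Relative

/-! ## Counting primes along a tower of number fields -/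

section TowerCount

variable (F : Type*) [Field F] [NumberField F] (E : Type*) [Field E] [NumberField E] [Algebra F E] [IsGalois F E]
  (M : Type*) [Field M] [NumberField M] [Algebra F M] [Algebra M E] [IsScalarTower F M E] [IsGalois F M]

/-- **The tower count `g_E(P) = g_M(P) · g_E(q)`** for Galois `M/F`, `E/F` and any prime `q` of `M` above `P` (Mathlib's
`Ideal.ncard_primesOver_mul_ncard_primesOver`, packaged for rings of integers). [cite: NeukirchANT1999, Ch. I §9 (9.1)–(9.2)] -/
theorem ncard_primesOver_mul_ncard_primesOver_of_base (P : Ideal (𝓞 F)) (q : Ideal (𝓞 M)) [q.IsPrime] [q.LiesOver P] :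
    (P.primesOver (𝓞 M)).ncard * (q.primesOver (𝓞 E)).ncard = (P.primesOver (𝓞 E)).ncard :=
  Ideal.ncard_primesOver_mul_ncard_primesOver q (M ≃ₐ[F] M) (𝓞 E) (E ≃ₐ[F] E)

/-- **`g_E(P) ≤ [E : M] · g_M(P)`** (each prime of `M` has at most `[E : M]` primes of `E` above it). [cite: NeukirchANT1999, Ch. I §9 (9.2)] -/
theorem ncard_primesOver_le_finrank_mul_of_base (P : Ideal (𝓞 F)) [P.IsMaximal] (hP : P ≠ ⊥) :
    (P.primesOver (𝓞 E)).ncard ≤ Module.finrank M E * (P.primesOver (𝓞 M)).ncard := by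
  obtain ⟨⟨q, hq, hqP⟩⟩ := P.nonempty_primesOver (S := 𝓞 M)
  haveI := hq
  haveI := hqP
  haveI : q.IsMaximal := hq.isMaximal (Ideal.ne_bot_of_liesOver_of_ne_bot hP q)
  haveI : IsGalois M E := IsGalois.tower_top_of_isGalois F M E
  rw [← ncard_primesOver_mul_ncard_primesOver_of_base F E M P q, mul_comm]
  refine Nat.mul_le_mul_right _ ?_
  exact Nat.le_of_dvd Module.finrank_pos (ncard_primesOver_dvd_finrank_of_base M E q)

end TowerCount

end Literature.NumberTheory.NumberFields

end
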